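import Summits.QuantumFields.BalabanUV.Beta.GAN24.ExponentialChartBaseHessianKernels
import Summits.QuantumFields.BalabanUV.Beta.GAN24.ExponentialChartHessianMoments

/-!
# `BalabanUV.Beta.GAN24.ExponentialChartBaseHessianMoments` — binder row G-an2-4 ∕ (CONV-C), route R7 «TWO CURRENCIES», PART 272: THE β-TYPE NUMBERS OF THE ONE-LOOP HESSIAN AT A
# NONZERO SMALL ABELIAN BACKGROUND ARE A SYMMETRIC BILINEAR FUNCTION OF THE DIRECTIONS (PART 259 §2 at the base point `U₀ = e^{iηA₀}`).  With `Π_k(A, B)` ANY infinite-volume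
# limit kernels of PART 269's families `H_{U₀,t}(A_t, B_t)` (every level) and `b_k = secondMoment (Π_k)`, `Π_∞ = limKernelOf Π`, `b_∞ = secondMoment Π_∞`: by PART 271
# (`Π(A, B) = Π(B, A)`, `Π(cA, B) = c·Π(A, B)`, `Π(A₁ + A₂, B) = Π(A₁, B) + Π(A₂, B)`, the same in `B`) and PART 259 §1's generic kernel-family algebra (`secondMoment_congr ∕
# _const_mul ∕ _add_of_summable`, `limKernelOf_congr_apply ∕ _const_mul_apply ∕ _add_apply_of_stepRate`, `secondMoment_limKernelOf_congr ∕ _const_mul ∕ _add_of_rate`):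
# **symmetry and homogeneity of `b_k`, `Π_∞`, `b_∞` with NO analytic hypothesis**, **additivity of `b_k` under (UD) `δ > 0`** (absolute convergence of (1.22)) **and of `b_∞` under
# the END's rates `|b_k − b_∞| ≤ c·θ^k`**, additivity of `Π_∞` under (PR′) — every hypothesis is a conjunct of PART 269's END (next file discharges them); the invertibility at the
# base is displayed for every volume and level (PART 271 §0 on the disc) (unit b2b-balaban-gan24-p3, gen 67; v1; generator `HOME/b2b-balaban-gan24-p3/gen67/records/gen/gen272.py`)

NOT IN PRINT; OUR PROOF ([folklore] bookkeeping BY NAME over PART 271 (`hessianAtKernel_symm ∕ _add_left ∕ _smul_left ∕ _add_right ∕ _smul_right`) and PART 259 §1; [Balaban1987RG1]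
(1.20)–(1.22) p. 264 LOCATE the shapes (`secondMoment` = Literature `B12Beta` (1.22)); nothing printed is a hypothesis).
HONEST FRAMING (cell contract, verbatim): «discharging `BetaPertH` makes Bałaban's UV stability UNCONDITIONAL — a real constructive-QFT result; it is NOT the
continuum limit and NOT the Clay problem.»  HONEST DEPENDENCY (verbatim): «continuum YM on T⁴ ⇐ BetaPertH ∧ nine spine estimates (0/9 proved); BetaPertH ⇐
(D1) ∧ (D4) ∧ CAP+tail; G-an2-4 gates asym, D1 and NE2/3/4.»

WHAT THIS FILE PROVES (0 sorry, 0 `def`; even cubic volumes, REAL `A₀` and directions, `Π` any `IsInfiniteVolumeLimit` kernels of the displayed families at every level, `h0 ∕ hc0`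
displayed):
* **`hessianAtMoments_symm`**, **`hessianAtMoments_smul_left`**, `hessianAtMoments_smul_right` — level numbers, telescoped limit kernels, limit numbers; NO analytic hypothesis.
* **`hessianAtMoments_add_left`**, `hessianAtMoments_add_right` — level numbers under (UD) `δ > 0`; limit numbers under the END's rates; `limKernelOf_hessianAtKernel_add_left` under (PR′).
WHAT IT DOES NOT DO: existence of the kernels and the (UD) ∕ rate hypotheses (PART 269's END — assembled in the next file); the diagonal.  SUPPLIER work; NEVER «G-an2-4 closed»;
NOT (CONV-C), NOT D1, NOT `BetaPertH`, NOT continuum, NOT Clay.  Records: `HOME/b2b-balaban-gan24-p3/gen67/README.md`.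
-/

noncomputable section

open scoped BigOperators ComplexConjugate Matrix Matrix.Norms.L2Operator
open Filter Topology

namespace Summit.QuantumFields.BalabanUV.Beta.GAN24.ExponentialChartBaseHessianMoments

open Literature.MathematicalPhysics.QuantumFieldTheory.Balaban1983to89
open Literature.MathematicalPhysics.QuantumFieldTheory.Balaban1983to89.B5Prop11Plancherel (Tor fine)
open Literature.MathematicalPhysics.QuantumFieldTheory.Balaban1983to89.B5G183RateUnitTower (lev)
open Literature.MathematicalPhysics.QuantumFieldTheory.Balaban1983to89.Beta (Site IsInfiniteVolumeLimit)
open Literature.MathematicalPhysics.QuantumFieldTheory.Balaban1983to89.Beta.FreeLegDictionary (cubic)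
open Literature.MathematicalPhysics.QuantumFieldTheory.Balaban1983to89.Beta.BlockKernelVolumeSockets (evenPeriod)
open Literature.MathematicalPhysics.QuantumFieldTheory.Balaban1983to89.Beta.LimitRate (UniformDecay StepRate limKernelOf)
open Summit.QuantumFields.BalabanUV.T4Continuum
open Summit.QuantumFields.BalabanUV.T4Continuum.CovariantAveragingTower (avgTow)
open Summit.QuantumFields.BalabanUV.T4Continuum.BalabanAveragedTowerUnit (idx QBlev)
open Summit.QuantumFields.BalabanUV.T4Continuum.BalabanAveragedCoerciveTower (unitIdx)
open Summit.QuantumFields.BalabanUV.T4Continuum.KingPairingPlantedLaw (calDalev)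
open Summit.QuantumFields.BalabanUV.T4Continuum.AbelianCovariantLaplacian (covPert)
open Summit.QuantumFields.BalabanUV.Beta.GAN24.ExponentialChartHessianMoments (secondMoment_congr secondMoment_add_of_summable secondMoment_const_mul limKernelOf_congr_apply
  limKernelOf_const_mul_apply limKernelOf_add_apply_of_stepRate secondMoment_limKernelOf_add_of_rate secondMoment_limKernelOf_const_mul secondMoment_limKernelOf_congr)
open Summit.QuantumFields.BalabanUV.Beta.GAN24.ExponentialChartBaseHessianKernels (hessianAtKernel_symm hessianAtKernel_add_left hessianAtKernel_smul_left hessianAtKernel_add_right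
  hessianAtKernel_smul_right)

variable {d : ℕ} (L : ℕ) [NeZero L] (a : ℝ) (ha : 0 < a)

/-- **`hessianAtMoments_symm` — THE β-TYPE NUMBERS OF THE HESSIAN AT `U₀` ARE SYMMETRIC IN THE DIRECTIONS**: for ANY infinite-volume limit kernels `Π` of PART 269's family of
`(A, B)` and `Π′` of `(B, A)` (every level, same base `A₀`): every level number, the telescoped limit kernels and the limit numbers agree — NO analytic hypothesis (PART 271's
`hessianAtKernel_symm` + PART 259 §1's congruences). [our proof] -/
theorem hessianAtMoments_symm {A₀ A B : (t : ℕ) → (k : ℕ) → Fin d → (idx L (cubic d (evenPeriod t)) k → ℝ)}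
    (h0 : ∀ t k, IsUnit (calDalev L (cubic d (evenPeriod t)) a ha k + covPert L (cubic d (evenPeriod t)) (fun k'' ν' (x' : idx L (cubic d (evenPeriod t)) k'') => Complex.exp (Complex.I *
          ((A₀ t) k'' ν' x' : ℂ) / ((lev L k'' : ℕ) : ℂ))) k).det)
    (hc0 : ∀ t k, IsUnit (avgTow (QBlev L (cubic d (evenPeriod t))) ((L : ℝ) ^ d) (fun k' => (calDalev L (cubic d (evenPeriod t)) a ha k' + covPert L (cubic d (evenPeriod t)) (fun k'' ν'
          (x' : idx L (cubic d (evenPeriod t)) k'') => Complex.exp (Complex.I * ((A₀ t) k'' ν' x' : ℂ) / ((lev L k'' : ℕ) : ℂ))) k')⁻¹) k).det) {P P' : ℕ → B12Beta.Kernel d}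
    (h : ∀ k, IsInfiniteVolumeLimit evenPeriod
      (fun t μ' ν' (z : Site d (evenPeriod t)) =>
          ((deriv (fun r : ℝ => deriv (fun s : ℝ => (avgTow (QBlev L (cubic d (evenPeriod t))) ((L : ℝ) ^ d)
          (fun k' => (calDalev L (cubic d (evenPeriod t)) a ha k' + covPert L (cubic d (evenPeriod t)) (fun k'' ν' (x' : idx L (cubic d (evenPeriod t)) k'') => Complex.exp
                (Complex.I * ((A₀ t) k'' ν' x' : ℂ) / ((lev L k'' : ℕ) : ℂ) + (Complex.I * ((A t) k'' ν' x' : ℂ) / ((lev L k'' : ℕ) : ℂ)) * ((s : ℝ) : ℂ) + (Complex.I * ((B t) k'' ν' x' :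
                      ℂ) / ((lev L k'' : ℕ) : ℂ)) * ((r : ℝ) :
                ℂ))) k')⁻¹) k)⁻¹) 0) 0)
            ((unitIdx L (cubic d (evenPeriod t))).symm (z, μ')) ((unitIdx L (cubic d (evenPeriod t))).symm (0, ν'))).re) (P k))
    (h' : ∀ k, IsInfiniteVolumeLimit evenPeriod
      (fun t μ' ν' (z : Site d (evenPeriod t)) =>
          ((deriv (fun r : ℝ => deriv (fun s : ℝ => (avgTow (QBlev L (cubic d (evenPeriod t))) ((L : ℝ) ^ d)
          (fun k' => (calDalev L (cubic d (evenPeriod t)) a ha k' + covPert L (cubic d (evenPeriod t)) (fun k'' ν' (x' : idx L (cubic d (evenPeriod t)) k'') => Complex.exp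
                (Complex.I * ((A₀ t) k'' ν' x' : ℂ) / ((lev L k'' : ℕ) : ℂ) + (Complex.I * ((B t) k'' ν' x' : ℂ) / ((lev L k'' : ℕ) : ℂ)) * ((s : ℝ) : ℂ) + (Complex.I * ((A t) k'' ν' x' :
                      ℂ) / ((lev L k'' : ℕ) : ℂ)) * ((r : ℝ) :
                ℂ))) k')⁻¹) k)⁻¹) 0) 0)
            ((unitIdx L (cubic d (evenPeriod t))).symm (z, μ')) ((unitIdx L (cubic d (evenPeriod t))).symm (0, ν'))).re) (P' k)) :
    (∀ k μ ν, B12Beta.secondMoment (P k) μ ν = B12Beta.secondMoment (P' k) μ ν) ∧ (∀ μ ν x, limKernelOf P μ ν x = limKernelOf P' μ ν x) ∧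
      ∀ μ ν, B12Beta.secondMoment (limKernelOf P) μ ν = B12Beta.secondMoment (limKernelOf P') μ ν := by
  have e : ∀ k μ ν x, P k μ ν x = P' k μ ν x := fun k => hessianAtKernel_symm L a ha k (fun t => h0 t k) (fun t => hc0 t k) (h k) (h' k)
  exact ⟨fun k μ ν => secondMoment_congr (e k μ ν), fun μ ν x => limKernelOf_congr_apply fun k => e k μ ν x, fun μ ν => secondMoment_limKernelOf_congr fun k => e k μ ν⟩

/-- **`hessianAtMoments_smul_left` — HOMOGENEITY IN THE FIRST DIRECTION** (real `c`): for ANY limit kernels `Π` of `(A, B)` and `Π_c` of `(cA, B)` at `U₀`: `b_k(cA, B) = c·b_k(A, B)`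
at every level, `limKernelOf Π_c = c·limKernelOf Π` pointwise, `b_∞(cA, B) = c·b_∞(A, B)` — NO analytic hypothesis (PART 271's `hessianAtKernel_smul_left`). [our proof] -/
theorem hessianAtMoments_smul_left (c : ℝ) {A₀ A B : (t : ℕ) → (k : ℕ) → Fin d → (idx L (cubic d (evenPeriod t)) k → ℝ)}
    (h0 : ∀ t k, IsUnit (calDalev L (cubic d (evenPeriod t)) a ha k + covPert L (cubic d (evenPeriod t)) (fun k'' ν' (x' : idx L (cubic d (evenPeriod t)) k'') => Complex.exp (Complex.I *
          ((A₀ t) k'' ν' x' : ℂ) / ((lev L k'' : ℕ) : ℂ))) k).det)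
    (hc0 : ∀ t k, IsUnit (avgTow (QBlev L (cubic d (evenPeriod t))) ((L : ℝ) ^ d) (fun k' => (calDalev L (cubic d (evenPeriod t)) a ha k' + covPert L (cubic d (evenPeriod t)) (fun k'' ν'
          (x' : idx L (cubic d (evenPeriod t)) k'') => Complex.exp (Complex.I * ((A₀ t) k'' ν' x' : ℂ) / ((lev L k'' : ℕ) : ℂ))) k')⁻¹) k).det) {P Pc : ℕ → B12Beta.Kernel d}
    (h : ∀ k, IsInfiniteVolumeLimit evenPeriod
      (fun t μ' ν' (z : Site d (evenPeriod t)) =>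
          ((deriv (fun r : ℝ => deriv (fun s : ℝ => (avgTow (QBlev L (cubic d (evenPeriod t))) ((L : ℝ) ^ d)
          (fun k' => (calDalev L (cubic d (evenPeriod t)) a ha k' + covPert L (cubic d (evenPeriod t)) (fun k'' ν' (x' : idx L (cubic d (evenPeriod t)) k'') => Complex.exp
                (Complex.I * ((A₀ t) k'' ν' x' : ℂ) / ((lev L k'' : ℕ) : ℂ) + (Complex.I * ((A t) k'' ν' x' : ℂ) / ((lev L k'' : ℕ) : ℂ)) * ((s : ℝ) : ℂ) + (Complex.I * ((B t) k'' ν' x' :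
                      ℂ) / ((lev L k'' : ℕ) : ℂ)) * ((r : ℝ) :
                ℂ))) k')⁻¹) k)⁻¹) 0) 0)
            ((unitIdx L (cubic d (evenPeriod t))).symm (z, μ')) ((unitIdx L (cubic d (evenPeriod t))).symm (0, ν'))).re) (P k))
    (hc : ∀ k, IsInfiniteVolumeLimit evenPeriod
      (fun t μ' ν' (z : Site d (evenPeriod t)) =>
          ((deriv (fun r : ℝ => deriv (fun s : ℝ => (avgTow (QBlev L (cubic d (evenPeriod t))) ((L : ℝ) ^ d)
          (fun k' => (calDalev L (cubic d (evenPeriod t)) a ha k' + covPert L (cubic d (evenPeriod t)) (fun k'' ν' (x' : idx L (cubic d (evenPeriod t)) k'') => Complex.exp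
                (Complex.I * ((A₀ t) k'' ν' x' : ℂ) / ((lev L k'' : ℕ) : ℂ) + (Complex.I * ((c * A t k'' ν' x' : ℝ) : ℂ) / ((lev L k'' : ℕ) : ℂ)) * ((s : ℝ) : ℂ) + (Complex.I * ((B t) k''
                      ν' x' : ℂ) / ((lev L k'' : ℕ) : ℂ)) * ((r : ℝ) :
                ℂ))) k')⁻¹) k)⁻¹) 0) 0)
            ((unitIdx L (cubic d (evenPeriod t))).symm (z, μ')) ((unitIdx L (cubic d (evenPeriod t))).symm (0, ν'))).re) (Pc k)) :
    (∀ k μ ν, B12Beta.secondMoment (Pc k) μ ν = c * B12Beta.secondMoment (P k) μ ν) ∧ (∀ μ ν x, limKernelOf Pc μ ν x = c * limKernelOf P μ ν x) ∧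
      ∀ μ ν, B12Beta.secondMoment (limKernelOf Pc) μ ν = c * B12Beta.secondMoment (limKernelOf P) μ ν := by
  have e : ∀ k μ ν x, Pc k μ ν x = c * P k μ ν x := fun k => hessianAtKernel_smul_left L a ha c k (fun t => h0 t k) (fun t => hc0 t k) (h k) (hc k)
  exact ⟨fun k μ ν => secondMoment_const_mul c (e k μ ν), fun μ ν x => limKernelOf_const_mul_apply c fun k => e k μ ν x,
    fun μ ν => secondMoment_limKernelOf_const_mul c fun k => e k μ ν⟩

/-- `hessianAtMoments_smul_right` — homogeneity in the second direction (PART 271's `hessianAtKernel_smul_right`), NO analytic hypothesis. [our proof] -/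
theorem hessianAtMoments_smul_right (c : ℝ) {A₀ A B : (t : ℕ) → (k : ℕ) → Fin d → (idx L (cubic d (evenPeriod t)) k → ℝ)}
    (h0 : ∀ t k, IsUnit (calDalev L (cubic d (evenPeriod t)) a ha k + covPert L (cubic d (evenPeriod t)) (fun k'' ν' (x' : idx L (cubic d (evenPeriod t)) k'') => Complex.exp (Complex.I *
          ((A₀ t) k'' ν' x' : ℂ) / ((lev L k'' : ℕ) : ℂ))) k).det)
    (hc0 : ∀ t k, IsUnit (avgTow (QBlev L (cubic d (evenPeriod t))) ((L : ℝ) ^ d) (fun k' => (calDalev L (cubic d (evenPeriod t)) a ha k' + covPert L (cubic d (evenPeriod t)) (fun k'' ν'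
          (x' : idx L (cubic d (evenPeriod t)) k'') => Complex.exp (Complex.I * ((A₀ t) k'' ν' x' : ℂ) / ((lev L k'' : ℕ) : ℂ))) k')⁻¹) k).det) {P Pc : ℕ → B12Beta.Kernel d}
    (h : ∀ k, IsInfiniteVolumeLimit evenPeriod
      (fun t μ' ν' (z : Site d (evenPeriod t)) =>
          ((deriv (fun r : ℝ => deriv (fun s : ℝ => (avgTow (QBlev L (cubic d (evenPeriod t))) ((L : ℝ) ^ d)
          (fun k' => (calDalev L (cubic d (evenPeriod t)) a ha k' + covPert L (cubic d (evenPeriod t)) (fun k'' ν' (x' : idx L (cubic d (evenPeriod t)) k'') => Complex.exp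
                (Complex.I * ((A₀ t) k'' ν' x' : ℂ) / ((lev L k'' : ℕ) : ℂ) + (Complex.I * ((A t) k'' ν' x' : ℂ) / ((lev L k'' : ℕ) : ℂ)) * ((s : ℝ) : ℂ) + (Complex.I * ((B t) k'' ν' x' :
                      ℂ) / ((lev L k'' : ℕ) : ℂ)) * ((r : ℝ) :
                ℂ))) k')⁻¹) k)⁻¹) 0) 0)
            ((unitIdx L (cubic d (evenPeriod t))).symm (z, μ')) ((unitIdx L (cubic d (evenPeriod t))).symm (0, ν'))).re) (P k))
    (hc : ∀ k, IsInfiniteVolumeLimit evenPeriod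
      (fun t μ' ν' (z : Site d (evenPeriod t)) =>
          ((deriv (fun r : ℝ => deriv (fun s : ℝ => (avgTow (QBlev L (cubic d (evenPeriod t))) ((L : ℝ) ^ d)
          (fun k' => (calDalev L (cubic d (evenPeriod t)) a ha k' + covPert L (cubic d (evenPeriod t)) (fun k'' ν' (x' : idx L (cubic d (evenPeriod t)) k'') => Complex.exp
                (Complex.I * ((A₀ t) k'' ν' x' : ℂ) / ((lev L k'' : ℕ) : ℂ) + (Complex.I * ((A t) k'' ν' x' : ℂ) / ((lev L k'' : ℕ) : ℂ)) * ((s : ℝ) : ℂ) + (Complex.I * ((c * B t k'' ν' x'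
                      : ℝ) : ℂ) / ((lev L k'' : ℕ) : ℂ)) * ((r : ℝ) :
                ℂ))) k')⁻¹) k)⁻¹) 0) 0)
            ((unitIdx L (cubic d (evenPeriod t))).symm (z, μ')) ((unitIdx L (cubic d (evenPeriod t))).symm (0, ν'))).re) (Pc k)) :
    (∀ k μ ν, B12Beta.secondMoment (Pc k) μ ν = c * B12Beta.secondMoment (P k) μ ν) ∧ (∀ μ ν x, limKernelOf Pc μ ν x = c * limKernelOf P μ ν x) ∧
      ∀ μ ν, B12Beta.secondMoment (limKernelOf Pc) μ ν = c * B12Beta.secondMoment (limKernelOf P) μ ν := by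
  have e : ∀ k μ ν x, Pc k μ ν x = c * P k μ ν x := fun k => hessianAtKernel_smul_right L a ha c k (fun t => h0 t k) (fun t => hc0 t k) (h k) (hc k)
  exact ⟨fun k μ ν => secondMoment_const_mul c (e k μ ν), fun μ ν x => limKernelOf_const_mul_apply c fun k => e k μ ν x,
    fun μ ν => secondMoment_limKernelOf_const_mul c fun k => e k μ ν⟩

/-- **`hessianAtMoments_add_left` — ADDITIVITY IN THE FIRST DIRECTION**: for ANY limit kernels `Π₁, Π₂, Π₁₂` of PART 269's families of `(A₁, B)`, `(A₂, B)`, `(A₁ + A₂, B)` at `U₀`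
(every level) and a pair `(μ, ν)`: (i) under (UD) `UniformDecay` with `δ > 0` for `Π₁, Π₂`, `b_k(A₁ + A₂, B) = b_k(A₁, B) + b_k(A₂, B)` at every level; (ii) if moreover the three
families have the END's rate `|b_k − b_∞| ≤ c·θ^k` (`0 ≤ θ < 1`), `b_∞(A₁ + A₂, B) = b_∞(A₁, B) + b_∞(A₂, B)` (PART 271's `hessianAtKernel_add_left`; PART 259 §1).  PART 269's END
supplies every hypothesis (next file). [our proof] -/
theorem hessianAtMoments_add_left {A₀ A₁ A₂ B : (t : ℕ) → (k : ℕ) → Fin d → (idx L (cubic d (evenPeriod t)) k → ℝ)}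
    (h0 : ∀ t k, IsUnit (calDalev L (cubic d (evenPeriod t)) a ha k + covPert L (cubic d (evenPeriod t)) (fun k'' ν' (x' : idx L (cubic d (evenPeriod t)) k'') => Complex.exp (Complex.I *
          ((A₀ t) k'' ν' x' : ℂ) / ((lev L k'' : ℕ) : ℂ))) k).det)
    (hc0 : ∀ t k, IsUnit (avgTow (QBlev L (cubic d (evenPeriod t))) ((L : ℝ) ^ d) (fun k' => (calDalev L (cubic d (evenPeriod t)) a ha k' + covPert L (cubic d (evenPeriod t)) (fun k'' ν'
          (x' : idx L (cubic d (evenPeriod t)) k'') => Complex.exp (Complex.I * ((A₀ t) k'' ν' x' : ℂ) / ((lev L k'' : ℕ) : ℂ))) k')⁻¹) k).det) {P₁ P₂ P₁₂ : ℕ → B12Beta.Kernel d}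
    (h₁ : ∀ k, IsInfiniteVolumeLimit evenPeriod
      (fun t μ' ν' (z : Site d (evenPeriod t)) =>
          ((deriv (fun r : ℝ => deriv (fun s : ℝ => (avgTow (QBlev L (cubic d (evenPeriod t))) ((L : ℝ) ^ d)
          (fun k' => (calDalev L (cubic d (evenPeriod t)) a ha k' + covPert L (cubic d (evenPeriod t)) (fun k'' ν' (x' : idx L (cubic d (evenPeriod t)) k'') => Complex.exp
                (Complex.I * ((A₀ t) k'' ν' x' : ℂ) / ((lev L k'' : ℕ) : ℂ) + (Complex.I * ((A₁ t) k'' ν' x' : ℂ) / ((lev L k'' : ℕ) : ℂ)) * ((s : ℝ) : ℂ) + (Complex.I * ((B t) k'' ν' x' :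
                      ℂ) / ((lev L k'' : ℕ) : ℂ)) * ((r : ℝ) :
                ℂ))) k')⁻¹) k)⁻¹) 0) 0)
            ((unitIdx L (cubic d (evenPeriod t))).symm (z, μ')) ((unitIdx L (cubic d (evenPeriod t))).symm (0, ν'))).re) (P₁ k))
    (h₂ : ∀ k, IsInfiniteVolumeLimit evenPeriod
      (fun t μ' ν' (z : Site d (evenPeriod t)) =>
          ((deriv (fun r : ℝ => deriv (fun s : ℝ => (avgTow (QBlev L (cubic d (evenPeriod t))) ((L : ℝ) ^ d)
          (fun k' => (calDalev L (cubic d (evenPeriod t)) a ha k' + covPert L (cubic d (evenPeriod t)) (fun k'' ν' (x' : idx L (cubic d (evenPeriod t)) k'') => Complex.exp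
                (Complex.I * ((A₀ t) k'' ν' x' : ℂ) / ((lev L k'' : ℕ) : ℂ) + (Complex.I * ((A₂ t) k'' ν' x' : ℂ) / ((lev L k'' : ℕ) : ℂ)) * ((s : ℝ) : ℂ) + (Complex.I * ((B t) k'' ν' x' :
                      ℂ) / ((lev L k'' : ℕ) : ℂ)) * ((r : ℝ) :
                ℂ))) k')⁻¹) k)⁻¹) 0) 0)
            ((unitIdx L (cubic d (evenPeriod t))).symm (z, μ')) ((unitIdx L (cubic d (evenPeriod t))).symm (0, ν'))).re) (P₂ k))
    (h₁₂ : ∀ k, IsInfiniteVolumeLimit evenPeriod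
      (fun t μ' ν' (z : Site d (evenPeriod t)) =>
          ((deriv (fun r : ℝ => deriv (fun s : ℝ => (avgTow (QBlev L (cubic d (evenPeriod t))) ((L : ℝ) ^ d)
          (fun k' => (calDalev L (cubic d (evenPeriod t)) a ha k' + covPert L (cubic d (evenPeriod t)) (fun k'' ν' (x' : idx L (cubic d (evenPeriod t)) k'') => Complex.exp
                (Complex.I * ((A₀ t) k'' ν' x' : ℂ) / ((lev L k'' : ℕ) : ℂ) + (Complex.I * ((A₁ t k'' ν' x' + A₂ t k'' ν' x' : ℝ) : ℂ) / ((lev L k'' : ℕ) : ℂ)) * ((s : ℝ) : ℂ) + (Complex.I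
                      * ((B t) k'' ν' x' : ℂ) / ((lev L k'' : ℕ) : ℂ)) * ((r : ℝ) :
                ℂ))) k')⁻¹) k)⁻¹) 0) 0)
            ((unitIdx L (cubic d (evenPeriod t))).symm (z, μ')) ((unitIdx L (cubic d (evenPeriod t))).symm (0, ν'))).re) (P₁₂ k))
    {μ ν : Fin d} {C₁ δ₁ C₂ δ₂ : ℝ} (hU₁ : UniformDecay P₁ μ ν C₁ δ₁) (hδ₁ : 0 < δ₁) (hU₂ : UniformDecay P₂ μ ν C₂ δ₂) (hδ₂ : 0 < δ₂) :
    (∀ k, B12Beta.secondMoment (P₁₂ k) μ ν = B12Beta.secondMoment (P₁ k) μ ν + B12Beta.secondMoment (P₂ k) μ ν) ∧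
      ∀ {c₁ c₂ c₁₂ θ : ℝ}, 0 ≤ θ → θ < 1 →
        (∀ k, |B12Beta.secondMoment (P₁ k) μ ν - B12Beta.secondMoment (limKernelOf P₁) μ ν| ≤ c₁ * θ ^ k) →
        (∀ k, |B12Beta.secondMoment (P₂ k) μ ν - B12Beta.secondMoment (limKernelOf P₂) μ ν| ≤ c₂ * θ ^ k) →
        (∀ k, |B12Beta.secondMoment (P₁₂ k) μ ν - B12Beta.secondMoment (limKernelOf P₁₂) μ ν| ≤ c₁₂ * θ ^ k) →
          B12Beta.secondMoment (limKernelOf P₁₂) μ ν = B12Beta.secondMoment (limKernelOf P₁) μ ν + B12Beta.secondMoment (limKernelOf P₂) μ ν := by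
  have e : ∀ k μ ν x, P₁₂ k μ ν x = P₁ k μ ν x + P₂ k μ ν x := fun k => hessianAtKernel_add_left L a ha k (fun t => h0 t k) (fun t => hc0 t k) (h₁ k) (h₂ k) (h₁₂ k)
  have hlev : ∀ k, B12Beta.secondMoment (P₁₂ k) μ ν = B12Beta.secondMoment (P₁ k) μ ν + B12Beta.secondMoment (P₂ k) μ ν := fun k =>
    secondMoment_add_of_summable (e k μ ν) (hU₁.summable hδ₁ k) (hU₂.summable hδ₂ k)
  exact ⟨hlev, fun hθ0 hθ1 hr₁ hr₂ hr₁₂ => secondMoment_limKernelOf_add_of_rate hθ0 hθ1 hr₁ hr₂ hr₁₂ hlev⟩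

/-- `limKernelOf_hessianAtKernel_add_left` — the telescoped limit KERNELS at `U₀` add in the `(μ, ν)` component under (PR′) `StepRate` for the two summands (`0 ≤ θ < 1`). [our proof] -/
theorem limKernelOf_hessianAtKernel_add_left {A₀ A₁ A₂ B : (t : ℕ) → (k : ℕ) → Fin d → (idx L (cubic d (evenPeriod t)) k → ℝ)}
    (h0 : ∀ t k, IsUnit (calDalev L (cubic d (evenPeriod t)) a ha k + covPert L (cubic d (evenPeriod t)) (fun k'' ν' (x' : idx L (cubic d (evenPeriod t)) k'') => Complex.exp (Complex.I *
          ((A₀ t) k'' ν' x' : ℂ) / ((lev L k'' : ℕ) : ℂ))) k).det)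
    (hc0 : ∀ t k, IsUnit (avgTow (QBlev L (cubic d (evenPeriod t))) ((L : ℝ) ^ d) (fun k' => (calDalev L (cubic d (evenPeriod t)) a ha k' + covPert L (cubic d (evenPeriod t)) (fun k'' ν'
          (x' : idx L (cubic d (evenPeriod t)) k'') => Complex.exp (Complex.I * ((A₀ t) k'' ν' x' : ℂ) / ((lev L k'' : ℕ) : ℂ))) k')⁻¹) k).det) {P₁ P₂ P₁₂ : ℕ → B12Beta.Kernel d}
    (h₁ : ∀ k, IsInfiniteVolumeLimit evenPeriod
      (fun t μ' ν' (z : Site d (evenPeriod t)) =>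
          ((deriv (fun r : ℝ => deriv (fun s : ℝ => (avgTow (QBlev L (cubic d (evenPeriod t))) ((L : ℝ) ^ d)
          (fun k' => (calDalev L (cubic d (evenPeriod t)) a ha k' + covPert L (cubic d (evenPeriod t)) (fun k'' ν' (x' : idx L (cubic d (evenPeriod t)) k'') => Complex.exp
                (Complex.I * ((A₀ t) k'' ν' x' : ℂ) / ((lev L k'' : ℕ) : ℂ) + (Complex.I * ((A₁ t) k'' ν' x' : ℂ) / ((lev L k'' : ℕ) : ℂ)) * ((s : ℝ) : ℂ) + (Complex.I * ((B t) k'' ν' x' :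
                      ℂ) / ((lev L k'' : ℕ) : ℂ)) * ((r : ℝ) :
                ℂ))) k')⁻¹) k)⁻¹) 0) 0)
            ((unitIdx L (cubic d (evenPeriod t))).symm (z, μ')) ((unitIdx L (cubic d (evenPeriod t))).symm (0, ν'))).re) (P₁ k))
    (h₂ : ∀ k, IsInfiniteVolumeLimit evenPeriod
      (fun t μ' ν' (z : Site d (evenPeriod t)) =>
          ((deriv (fun r : ℝ => deriv (fun s : ℝ => (avgTow (QBlev L (cubic d (evenPeriod t))) ((L : ℝ) ^ d)
          (fun k' => (calDalev L (cubic d (evenPeriod t)) a ha k' + covPert L (cubic d (evenPeriod t)) (fun k'' ν' (x' : idx L (cubic d (evenPeriod t)) k'') => Complex.exp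
                (Complex.I * ((A₀ t) k'' ν' x' : ℂ) / ((lev L k'' : ℕ) : ℂ) + (Complex.I * ((A₂ t) k'' ν' x' : ℂ) / ((lev L k'' : ℕ) : ℂ)) * ((s : ℝ) : ℂ) + (Complex.I * ((B t) k'' ν' x' :
                      ℂ) / ((lev L k'' : ℕ) : ℂ)) * ((r : ℝ) :
                ℂ))) k')⁻¹) k)⁻¹) 0) 0)
            ((unitIdx L (cubic d (evenPeriod t))).symm (z, μ')) ((unitIdx L (cubic d (evenPeriod t))).symm (0, ν'))).re) (P₂ k))
    (h₁₂ : ∀ k, IsInfiniteVolumeLimit evenPeriod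
      (fun t μ' ν' (z : Site d (evenPeriod t)) =>
          ((deriv (fun r : ℝ => deriv (fun s : ℝ => (avgTow (QBlev L (cubic d (evenPeriod t))) ((L : ℝ) ^ d)
          (fun k' => (calDalev L (cubic d (evenPeriod t)) a ha k' + covPert L (cubic d (evenPeriod t)) (fun k'' ν' (x' : idx L (cubic d (evenPeriod t)) k'') => Complex.exp
                (Complex.I * ((A₀ t) k'' ν' x' : ℂ) / ((lev L k'' : ℕ) : ℂ) + (Complex.I * ((A₁ t k'' ν' x' + A₂ t k'' ν' x' : ℝ) : ℂ) / ((lev L k'' : ℕ) : ℂ)) * ((s : ℝ) : ℂ) + (Complex.I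
                      * ((B t) k'' ν' x' : ℂ) / ((lev L k'' : ℕ) : ℂ)) * ((r : ℝ) :
                ℂ))) k')⁻¹) k)⁻¹) 0) 0)
            ((unitIdx L (cubic d (evenPeriod t))).symm (z, μ')) ((unitIdx L (cubic d (evenPeriod t))).symm (0, ν'))).re) (P₁₂ k))
    {μ ν : Fin d} {C₁ δ₁ C₂ δ₂ θ : ℝ} (hθ0 : 0 ≤ θ) (hθ1 : θ < 1) (hS₁ : StepRate P₁ μ ν C₁ δ₁ θ) (hS₂ : StepRate P₂ μ ν C₂ δ₂ θ) (x : Fin d → ℤ) :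
    limKernelOf P₁₂ μ ν x = limKernelOf P₁ μ ν x + limKernelOf P₂ μ ν x :=
  limKernelOf_add_apply_of_stepRate hθ0 hθ1 hS₁ hS₂ (fun k x => hessianAtKernel_add_left L a ha k (fun t => h0 t k) (fun t => hc0 t k) (h₁ k) (h₂ k) (h₁₂ k) μ ν x) x

/-- `hessianAtMoments_add_right` — additivity in the second direction, level numbers under (UD) and limit numbers under the END's rates (PART 271's `hessianAtKernel_add_right`;
PART 259 §1). [our proof] -/
theorem hessianAtMoments_add_right {A₀ A B₁ B₂ : (t : ℕ) → (k : ℕ) → Fin d → (idx L (cubic d (evenPeriod t)) k → ℝ)}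
    (h0 : ∀ t k, IsUnit (calDalev L (cubic d (evenPeriod t)) a ha k + covPert L (cubic d (evenPeriod t)) (fun k'' ν' (x' : idx L (cubic d (evenPeriod t)) k'') => Complex.exp (Complex.I *
          ((A₀ t) k'' ν' x' : ℂ) / ((lev L k'' : ℕ) : ℂ))) k).det)
    (hc0 : ∀ t k, IsUnit (avgTow (QBlev L (cubic d (evenPeriod t))) ((L : ℝ) ^ d) (fun k' => (calDalev L (cubic d (evenPeriod t)) a ha k' + covPert L (cubic d (evenPeriod t)) (fun k'' ν'
          (x' : idx L (cubic d (evenPeriod t)) k'') => Complex.exp (Complex.I * ((A₀ t) k'' ν' x' : ℂ) / ((lev L k'' : ℕ) : ℂ))) k')⁻¹) k).det) {P₁ P₂ P₁₂ : ℕ → B12Beta.Kernel d}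
    (h₁ : ∀ k, IsInfiniteVolumeLimit evenPeriod
      (fun t μ' ν' (z : Site d (evenPeriod t)) =>
          ((deriv (fun r : ℝ => deriv (fun s : ℝ => (avgTow (QBlev L (cubic d (evenPeriod t))) ((L : ℝ) ^ d)
          (fun k' => (calDalev L (cubic d (evenPeriod t)) a ha k' + covPert L (cubic d (evenPeriod t)) (fun k'' ν' (x' : idx L (cubic d (evenPeriod t)) k'') => Complex.exp
                (Complex.I * ((A₀ t) k'' ν' x' : ℂ) / ((lev L k'' : ℕ) : ℂ) + (Complex.I * ((A t) k'' ν' x' : ℂ) / ((lev L k'' : ℕ) : ℂ)) * ((s : ℝ) : ℂ) + (Complex.I * ((B₁ t) k'' ν' x' :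
                      ℂ) / ((lev L k'' : ℕ) : ℂ)) * ((r : ℝ) :
                ℂ))) k')⁻¹) k)⁻¹) 0) 0)
            ((unitIdx L (cubic d (evenPeriod t))).symm (z, μ')) ((unitIdx L (cubic d (evenPeriod t))).symm (0, ν'))).re) (P₁ k))
    (h₂ : ∀ k, IsInfiniteVolumeLimit evenPeriod
      (fun t μ' ν' (z : Site d (evenPeriod t)) =>
          ((deriv (fun r : ℝ => deriv (fun s : ℝ => (avgTow (QBlev L (cubic d (evenPeriod t))) ((L : ℝ) ^ d)
          (fun k' => (calDalev L (cubic d (evenPeriod t)) a ha k' + covPert L (cubic d (evenPeriod t)) (fun k'' ν' (x' : idx L (cubic d (evenPeriod t)) k'') => Complex.exp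
                (Complex.I * ((A₀ t) k'' ν' x' : ℂ) / ((lev L k'' : ℕ) : ℂ) + (Complex.I * ((A t) k'' ν' x' : ℂ) / ((lev L k'' : ℕ) : ℂ)) * ((s : ℝ) : ℂ) + (Complex.I * ((B₂ t) k'' ν' x' :
                      ℂ) / ((lev L k'' : ℕ) : ℂ)) * ((r : ℝ) :
                ℂ))) k')⁻¹) k)⁻¹) 0) 0)
            ((unitIdx L (cubic d (evenPeriod t))).symm (z, μ')) ((unitIdx L (cubic d (evenPeriod t))).symm (0, ν'))).re) (P₂ k))
    (h₁₂ : ∀ k, IsInfiniteVolumeLimit evenPeriod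
      (fun t μ' ν' (z : Site d (evenPeriod t)) =>
          ((deriv (fun r : ℝ => deriv (fun s : ℝ => (avgTow (QBlev L (cubic d (evenPeriod t))) ((L : ℝ) ^ d)
          (fun k' => (calDalev L (cubic d (evenPeriod t)) a ha k' + covPert L (cubic d (evenPeriod t)) (fun k'' ν' (x' : idx L (cubic d (evenPeriod t)) k'') => Complex.exp
                (Complex.I * ((A₀ t) k'' ν' x' : ℂ) / ((lev L k'' : ℕ) : ℂ) + (Complex.I * ((A t) k'' ν' x' : ℂ) / ((lev L k'' : ℕ) : ℂ)) * ((s : ℝ) : ℂ) + (Complex.I * ((B₁ t k'' ν' x' +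
                      B₂ t k'' ν' x' : ℝ) : ℂ) / ((lev L k'' : ℕ) : ℂ)) * ((r : ℝ) :
                ℂ))) k')⁻¹) k)⁻¹) 0) 0)
            ((unitIdx L (cubic d (evenPeriod t))).symm (z, μ')) ((unitIdx L (cubic d (evenPeriod t))).symm (0, ν'))).re) (P₁₂ k))
    {μ ν : Fin d} {C₁ δ₁ C₂ δ₂ : ℝ} (hU₁ : UniformDecay P₁ μ ν C₁ δ₁) (hδ₁ : 0 < δ₁) (hU₂ : UniformDecay P₂ μ ν C₂ δ₂) (hδ₂ : 0 < δ₂) :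
    (∀ k, B12Beta.secondMoment (P₁₂ k) μ ν = B12Beta.secondMoment (P₁ k) μ ν + B12Beta.secondMoment (P₂ k) μ ν) ∧
      ∀ {c₁ c₂ c₁₂ θ : ℝ}, 0 ≤ θ → θ < 1 →
        (∀ k, |B12Beta.secondMoment (P₁ k) μ ν - B12Beta.secondMoment (limKernelOf P₁) μ ν| ≤ c₁ * θ ^ k) →
        (∀ k, |B12Beta.secondMoment (P₂ k) μ ν - B12Beta.secondMoment (limKernelOf P₂) μ ν| ≤ c₂ * θ ^ k) →
        (∀ k, |B12Beta.secondMoment (P₁₂ k) μ ν - B12Beta.secondMoment (limKernelOf P₁₂) μ ν| ≤ c₁₂ * θ ^ k) →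
          B12Beta.secondMoment (limKernelOf P₁₂) μ ν = B12Beta.secondMoment (limKernelOf P₁) μ ν + B12Beta.secondMoment (limKernelOf P₂) μ ν := by
  have e : ∀ k μ ν x, P₁₂ k μ ν x = P₁ k μ ν x + P₂ k μ ν x := fun k => hessianAtKernel_add_right L a ha k (fun t => h0 t k) (fun t => hc0 t k) (h₁ k) (h₂ k) (h₁₂ k)
  have hlev : ∀ k, B12Beta.secondMoment (P₁₂ k) μ ν = B12Beta.secondMoment (P₁ k) μ ν + B12Beta.secondMoment (P₂ k) μ ν := fun k =>
    secondMoment_add_of_summable (e k μ ν) (hU₁.summable hδ₁ k) (hU₂.summable hδ₂ k)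
  exact ⟨hlev, fun hθ0 hθ1 hr₁ hr₂ hr₁₂ => secondMoment_limKernelOf_add_of_rate hθ0 hθ1 hr₁ hr₂ hr₁₂ hlev⟩

end Summit.QuantumFields.BalabanUV.Beta.GAN24.ExponentialChartBaseHessianMoments

end
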